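import Summits.QuantumFields.BalabanUV.T4Continuum.Support.NE3NestedBlockMeanCovariance
import Summits.QuantumFields.BalabanUV.T4Continuum.Support.NE3TangentCovariantTower
import Summits.QuantumFields.BalabanUV.T4Continuum.Support.ReplicationRightInverse
import Summits.QuantumFields.BalabanUV.T4Continuum.Support.AveragingDeficitLocality
import Summits.QuantumFields.BalabanUV.T4Continuum.Support.AveragingDeficitNearIdentity
import HarnessLib

/-!
# T⁴ programme, node NE3 — route Π, row Π-R (curved step), file Π-R-W1: FINITE GAUGE COVARIANCE OF THE LINEARISED AVERAGE AND OF ITS TOWER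
# `cpush L (W^u) (ψ^u) = (cpush L W ψ)^{u∘L•}`, `cpushIter L j (W^u) (ψ^u) = (cpushIter L j W ψ)^{u∘L^{j+1}•}`, `dirIter` likewise

NE3 (node U1b) formalisation swarm, leaf seat `b2b-balaban-t4-ne3-formalise-leaf-01` (gen 7); design note D-ne3leaf01g7-2 (`HOME/CLAIMS.log` l.22114, memo
`HOME/b2b-balaban-t4-ne3-formalise-leaf-01/g7/PI-RW-DESIGN-leaf01g7.md` §2 (2), file W1).  The k-level input (K1) of the tree
(`BlockAveragePushDirGauge.pushDir_gaugeDir`, leaf-10; `NE3TangentCovariantStructure.cpush_gaugeDir`, leaf-04) is the INFINITESIMAL-gauge form of B7's exact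
covariance (45): gauge DIRECTIONS go to gauge directions.  The curved right inverse needs the FINITE-gauge form for an arbitrary direction: under a unitary
gauge transformation `u` of the background, `W ↦ W^u = gaugeAct u W`, a direction `ψ` (the velocity of `W·e^{sψ}`) is dressed as `ψ^u(x,μ) = Ad_{u(x+e_μ)} ψ(x,μ)`
(`vary_gaugeAct`: `(W·e^{sψ})^u = W^u·e^{sψ^u}` EXACTLY), and the push-forward through Bałaban's average is dressed by `u` read at the END of the coarse bond:
**`pushDir L (W^u) (ψ^u) (q,κ) = Ad_{u(q+Le_κ)} (pushDir L W ψ (q,κ))`** (`pushDir_gaugeAct`) — by differentiating (45) `bavg_gaugeAct` along `s ↦ W·e^{sψ}` inside the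
loop-analyticity ball (`hasDerivAt_val_bavg_vary`, `eventually_norm_Wcx_vary_sub_one_lt`, uniqueness of derivatives), with NO smallness beyond the loop ball
`‖W(Γ_{c,x})W(c)⁻¹ − 1‖ < 1` of (42).  Read on the coarse lattices and iterated through the tower (backgrounds by NE3-R2's `cavg_gaugeAct`, class bookkeeping by
leaf-04's `step_small`): `cpush_gaugeAct`, `cavgIter_gaugeAct`, **`cpushIter_gaugeAct`**, `dirIter_succ_eq_cpushIter`, **`dirIter_gaugeAct`**; and the algebraic
`gaugeDir_gaugeAct` (`gaugeDir (W^u) (Ad_u λ) = (gaugeDir W λ)^u`).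

CONTENT ([folklore] over the tree's B7 transcription BY NAME; 0 sorry; 0 def): §1 `vary_gaugeAct`, `norm_Wcx_gaugeAct_sub_one`, **`pushDir_gaugeAct`**, `cpush_gaugeAct`,
`gaugeDir_gaugeAct`; §2 `cavgIter_gaugeAct`, **`cpushIter_gaugeAct`**, `dirIter_succ_eq_cpushIter`, **`dirIter_gaugeAct`**.

HONEST FRAMING.  Exact kinematic identities of OUR transcription of (42)∕(45) (context: [Balaban1985Averaging] (45) p. 24); nothing about minimisers; (P♮)_W, T-E_w and
**NE3 are NOT proved**; spine PROVED 0∕9; finite T⁴ rung (B)+1 — NOT infinite volume, NOT mass gap, NOT `BetaPertH`, NOT Clay.  PLACEMENT: `Summits/QuantumFields/BalabanUV/`.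
HONEST DEPENDENCY (cell page 1): continuum YM on T⁴ ⇐ BetaPertH ∧ nine spine estimates (0/9 proved); BetaPertH ⇐ (D1) ∧ (D4) ∧ CAP+tail; G-an2-4 gates asym, D1 and NE2/3/4.
-/

set_option autoImplicit false

open scoped BigOperators Matrix.Norms.L2Operator Topology
open Finset Filter

namespace Summit.QuantumFields.BalabanUV.T4Continuum.NE3CpushGaugeCovariance

open Literature.MathematicalPhysics.QuantumFieldTheory.Balaban1983to89
open B7Prop1Explicit B7Prop2Explicit
open T4AveragingDeficitWall (IsUnitaryCfg SmallField Ad vary norm_Wcx_sub_one_lt_one_of_smallField)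
open AveragingDeficitTransport (norm_Ad_of_unitary mem_U1_of_unitary)
open AveragingDeficitLocality (expUnit_Ad)
open AveragingDeficitNearIdentity (Ad_smul)
open AveragingDeficitSideDeriv (sideDeriv hasDerivAt_val_bavg_vary eventually_norm_Wcx_vary_sub_one_lt)
open AveragingDeficitResidualPairing (pushDir)
open AveragingDeficitChartCalculus (cavg)
open AveragingDeficitMultiLevelPrep (cpush cavgIter LevelSmall)
open NE3TangentCovariantTower (dirIter step_small cavgIter_succ)
open NE3NestedBlockMeanCovariance (cavg_gaugeAct)
open ReplicationRightInverse (cpushIter)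
open BlockAveragePushDirGauge (gaugeDir)

noncomputable section

variable {d : ℕ} {n : Type*} [Fintype n] [DecidableEq n]

/-! ## §1 One level -/

/-- **THE DRESSED VARIATION**: `(W·e^{sψ})^u = W^u·e^{sψ^u}` with `ψ^u(x,μ) = Ad_{u(x+e_μ)} ψ(x,μ)` — exactly, for every `s`. [cite: Balaban1985Averaging, (8) p.18] -/
theorem vary_gaugeAct (u : Site d → (Matrix n n ℂ)ˣ) (V : Site d → Fin d → (Matrix n n ℂ)ˣ) (ψ : Site d → Fin d → (Matrix n n ℂ)) (s : ℝ) :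
    vary (gaugeAct u V) (fun x μ => Ad (u (x + e μ)) (ψ x μ)) s = gaugeAct u (vary V ψ s) := by
  funext x μ
  simp only [vary, gaugeAct]
  rw [← Ad_smul, expUnit_Ad]
  simp only [mul_assoc, inv_mul_cancel_left]

/-- The loop variables of a gauge transform are the conjugated loop variables: `‖W^u(Γ_{c,x})W^u(c)⁻¹ − 1‖ = ‖W(Γ_{c,x})W(c)⁻¹ − 1‖` (`u` unitary). [folklore] -/
theorem norm_Wcx_gaugeAct_sub_one (L : ℕ) {u : Site d → (Matrix n n ℂ)ˣ} (hu : ∀ x, u x ∈ unitaryUnits (Matrix n n ℂ)) (V : Site d → Fin d → (Matrix n n ℂ)ˣ)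
    (q : Site d) (κ : Fin d) (r : Site d) :
    ‖((Wcx L (gaugeAct u V) q κ r : (Matrix n n ℂ)ˣ) : (Matrix n n ℂ)) - 1‖ = ‖((Wcx L V q κ r : (Matrix n n ℂ)ˣ) : (Matrix n n ℂ)) - 1‖ := by
  rw [Wcx_gaugeAct]
  have h : ((u q * Wcx L V q κ r * (u q)⁻¹ : (Matrix n n ℂ)ˣ) : (Matrix n n ℂ)) - 1 = Ad (u q) (((Wcx L V q κ r : (Matrix n n ℂ)ˣ) : (Matrix n n ℂ)) - 1) := by
    simp only [Ad, Units.val_mul, mul_sub, sub_mul, mul_one, Units.mul_inv]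
  rw [h, norm_Ad_of_unitary (hu q)]

/-- **FINITE GAUGE COVARIANCE OF THE LINEARISED AVERAGE (one bond)**: inside the loop ball of (42),
`pushDir L (W^u) (ψ^u) (q,κ) = Ad_{u(q + L e_κ)} (pushDir L W ψ (q,κ))` — the derivative of (45) along `W·e^{sψ}`. [cite: Balaban1985Averaging, (45) p.24] -/
theorem pushDir_gaugeAct [Nonempty n] (L : ℕ) {u : Site d → (Matrix n n ℂ)ˣ} (hu : ∀ x, u x ∈ unitaryUnits (Matrix n n ℂ)) (V : Site d → Fin d → (Matrix n n ℂ)ˣ)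
    (ψ : Site d → Fin d → (Matrix n n ℂ)) (q : Site d) (κ : Fin d)
    (hW : ∀ r : Fin d → Fin L, ‖((Wcx L V q κ (boxVec L r) : (Matrix n n ℂ)ˣ) : (Matrix n n ℂ)) - 1‖ < 1) :
    pushDir L (gaugeAct u V) (fun x μ => Ad (u (x + e μ)) (ψ x μ)) q κ = Ad (u (q + (L : ℤ) • e κ)) (pushDir L V ψ q κ) := by
  set V' : Site d → Fin d → (Matrix n n ℂ)ˣ := gaugeAct u V with hV'
  set ψ' : Site d → Fin d → (Matrix n n ℂ) := fun x μ => Ad (u (x + e μ)) (ψ x μ) with hψ'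
  set q' : Site d := q + (L : ℤ) • e κ with hq'
  have hU1 : ∀ x, u x ∈ U1 (Matrix n n ℂ) := fun x => mem_U1_of_unitary (hu x)
  have hW' : ∀ r : Fin d → Fin L, ‖((Wcx L V' q κ (boxVec L r) : (Matrix n n ℂ)ˣ) : (Matrix n n ℂ)) - 1‖ < 1 := fun r => by
    rw [hV', norm_Wcx_gaugeAct_sub_one L hu]; exact hW r
  -- the derivative of `s ↦ bavg (vary V' ψ' s)` at `0`, computed at `V'` …
  have h1 := hasDerivAt_val_bavg_vary L V' ψ' q κ hW'
  -- … and through (45) applied to `vary V ψ s`, valid for `s` near `0`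
  have hev : ∀ᶠ s in 𝓝 (0 : ℝ), ∀ r : Fin d → Fin L, ‖((Wcx L (vary V ψ s) q κ (boxVec L r) : (Matrix n n ℂ)ˣ) : (Matrix n n ℂ)) - 1‖ < 1 :=
    Filter.eventually_all.mpr fun r => eventually_norm_Wcx_vary_sub_one_lt L V ψ q κ (boxVec L r) (hW r)
  have h2 : HasDerivAt (fun s : ℝ => ((bavg L (vary V' ψ' s) q κ : (Matrix n n ℂ)ˣ) : (Matrix n n ℂ)))
      (((u q : (Matrix n n ℂ)ˣ) : (Matrix n n ℂ)) * (sideDeriv L V ψ q κ * ((bavg L V q κ : (Matrix n n ℂ)ˣ) : (Matrix n n ℂ))) * (((u q')⁻¹ : (Matrix n n ℂ)ˣ) : (Matrix n n ℂ))) 0 := by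
    have hd := ((hasDerivAt_val_bavg_vary L V ψ q κ hW).const_mul (((u q : (Matrix n n ℂ)ˣ) : (Matrix n n ℂ)))).mul_const ((((u q')⁻¹ : (Matrix n n ℂ)ˣ) : (Matrix n n ℂ)))
    refine hd.congr_of_eventuallyEq (hev.mono fun s hs => ?_)
    show ((bavg L (vary V' ψ' s) q κ : (Matrix n n ℂ)ˣ) : (Matrix n n ℂ)) = ((u q : (Matrix n n ℂ)ˣ) : (Matrix n n ℂ)) * ((bavg L (vary V ψ s) q κ : (Matrix n n ℂ)ˣ) : (Matrix n n ℂ)) * (((u q')⁻¹ : (Matrix n n ℂ)ˣ) : (Matrix n n ℂ))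
    rw [hV', hψ', vary_gaugeAct, bavg_gaugeAct L hU1 (vary V ψ s) q κ hs, hq']
    simp only [Units.val_mul]
  have huniq := h1.unique h2
  have hb' : bavg L V' q κ = u q * bavg L V q κ * (u q')⁻¹ := by rw [hV', hq']; exact bavg_gaugeAct L hU1 V q κ hW
  have hbinv : (bavg L V' q κ)⁻¹ = u q' * (bavg L V q κ)⁻¹ * (u q)⁻¹ := by
    rw [hb', mul_inv_rev, mul_inv_rev, inv_inv, mul_assoc]
  -- solve: `Ad_{b'⁻¹} σ' = b'⁻¹ (σ' b') b'⁻¹… = Ad_{u'} (Ad_{b⁻¹} σ)`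
  show Ad (bavg L V' q κ)⁻¹ (sideDeriv L V' ψ' q κ) = Ad (u q') (Ad (bavg L V q κ)⁻¹ (sideDeriv L V ψ q κ))
  simp only [Ad, inv_inv]
  calc (((bavg L V' q κ)⁻¹ : (Matrix n n ℂ)ˣ) : (Matrix n n ℂ)) * sideDeriv L V' ψ' q κ * ((bavg L V' q κ : (Matrix n n ℂ)ˣ) : (Matrix n n ℂ))
      = (((bavg L V' q κ)⁻¹ : (Matrix n n ℂ)ˣ) : (Matrix n n ℂ)) * (sideDeriv L V' ψ' q κ * ((bavg L V' q κ : (Matrix n n ℂ)ˣ) : (Matrix n n ℂ))) := by rw [mul_assoc]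
    _ = ((u q' * (bavg L V q κ)⁻¹ * (u q)⁻¹ : (Matrix n n ℂ)ˣ) : (Matrix n n ℂ))
          * (((u q : (Matrix n n ℂ)ˣ) : (Matrix n n ℂ)) * (sideDeriv L V ψ q κ * ((bavg L V q κ : (Matrix n n ℂ)ˣ) : (Matrix n n ℂ))) * (((u q')⁻¹ : (Matrix n n ℂ)ˣ) : (Matrix n n ℂ))) := by rw [huniq, hbinv]
    _ = ((u q' : (Matrix n n ℂ)ˣ) : (Matrix n n ℂ)) * ((((bavg L V q κ)⁻¹ : (Matrix n n ℂ)ˣ) : (Matrix n n ℂ)) * sideDeriv L V ψ q κ * ((bavg L V q κ : (Matrix n n ℂ)ˣ) : (Matrix n n ℂ)))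
          * (((u q')⁻¹ : (Matrix n n ℂ)ˣ) : (Matrix n n ℂ)) := by
        simp only [Units.val_mul, mul_assoc, Units.inv_mul_cancel_left]

/-- **FINITE GAUGE COVARIANCE OF THE LINEARISED AVERAGE, READ ON THE COARSE LATTICE**: in the small-field class (`512(d+1)(d+4)L²a ≤ 1`),
`cpush L (W^u) (ψ^u) = (cpush L W ψ)^{u ∘ L•}`, i.e. `cpush L (W^u) (ψ^u) (z,κ) = Ad_{u(L(z+e_κ))} (cpush L W ψ (z,κ))`. [cite: Balaban1985Averaging, (45) p.24] -/
theorem cpush_gaugeAct [Nonempty n] {L : ℕ} (hL : 1 ≤ L) {W : Site d → Fin d → (Matrix n n ℂ)ˣ} (hWu : IsUnitaryCfg W) {a : ℝ} (ha : 0 ≤ a)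
    (h512 : 512 * (d + 1) * (d + 4) * (L : ℝ) ^ 2 * a ≤ 1) (hWa : SmallField W a)
    {u : Site d → (Matrix n n ℂ)ˣ} (hu : ∀ x, u x ∈ unitaryUnits (Matrix n n ℂ)) (ψ : Site d → Fin d → (Matrix n n ℂ)) :
    cpush L (gaugeAct u W) (fun x μ => Ad (u (x + e μ)) (ψ x μ))
      = fun z κ => Ad (u ((L : ℤ) • (z + e κ))) (cpush L W ψ z κ) := by
  funext z κ
  show pushDir L (gaugeAct u W) (fun x μ => Ad (u (x + e μ)) (ψ x μ)) ((L : ℤ) • z) κ = _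
  rw [pushDir_gaugeAct L hu W ψ _ κ (norm_Wcx_sub_one_lt_one_of_smallField L hL hWu ha h512 hWa _ κ), smul_add]
  rfl

/-- **GAUGE DIRECTIONS DRESS COVARIANTLY** (pure algebra): `gaugeDir (W^u) (Ad_u λ) = (gaugeDir W λ)^u`. [folklore] -/
theorem gaugeDir_gaugeAct (u : Site d → (Matrix n n ℂ)ˣ) (W : Site d → Fin d → (Matrix n n ℂ)ˣ) (lam : Site d → (Matrix n n ℂ)) :
    gaugeDir (gaugeAct u W) (fun x => Ad (u x) (lam x)) = fun x μ => Ad (u (x + e μ)) (gaugeDir W lam x μ) := by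
  funext x μ
  simp only [gaugeDir, gaugeAct, Ad, mul_inv_rev, inv_inv, Units.val_mul, mul_sub, sub_mul]
  congr 1
  simp only [mul_assoc, Units.inv_mul_cancel_left]

/-! ## §2 The tower -/

/-- `cavgIter L 0 W = W`. [folklore] -/
theorem cavgIter_zero' (L : ℕ) (W : Site d → Fin d → (Matrix n n ℂ)ˣ) : cavgIter L 0 W = W := rfl

/-- `cpushIter L 0 W ψ = cpush L W ψ`. [folklore] -/
theorem cpushIter_zero' (L : ℕ) (W : Site d → Fin d → (Matrix n n ℂ)ˣ) (ψ : Site d → Fin d → (Matrix n n ℂ)) : cpushIter L 0 W ψ = cpush L W ψ := rfl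

/-- `cpushIter L (j+1) W ψ = cpushIter L j (cavg L W) (cpush L W ψ)`. [folklore] -/
theorem cpushIter_succ' (L j : ℕ) (W : Site d → Fin d → (Matrix n n ℂ)ˣ) (ψ : Site d → Fin d → (Matrix n n ℂ)) :
    cpushIter L (j + 1) W ψ = cpushIter L j (cavg L W) (cpush L W ψ) := rfl

/-- **COVARIANCE OF THE ITERATED AVERAGE**: in the multi-level small-field class, `cavgIter L (j+1) (W^u) = (cavgIter L (j+1) W)^{u ∘ L^{j+1}•}`.
[cite: Balaban1985Averaging, (45) p.24] -/
theorem cavgIter_gaugeAct [Nonempty n] {L : ℕ} (hL : 1 ≤ L) (j : ℕ) :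
    ∀ {W : Site d → Fin d → (Matrix n n ℂ)ˣ} {x : ℝ}, IsUnitaryCfg W → 0 ≤ x → LevelSmall d L j x → SmallField W x →
    ∀ {u : Site d → (Matrix n n ℂ)ˣ}, (∀ y, u y ∈ unitaryUnits (Matrix n n ℂ)) →
      cavgIter L (j + 1) (gaugeAct u W) = gaugeAct (fun w => u (((L : ℤ) ^ (j + 1)) • w)) (cavgIter L (j + 1) W) := by
  induction j with
  | zero =>
      intro W x hWu hx hs hWx u hu
      obtain ⟨h512, -, -, -⟩ := step_small hL hWu hx hs hWx
      rw [cavgIter_succ, cavgIter_succ, cavgIter_zero', cavgIter_zero', zero_add, pow_one]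
      exact cavg_gaugeAct hL hWu hx h512 hWx hu
  | succ j ih =>
      intro W x hWu hx hs hWx u hu
      obtain ⟨h512, hW₁u, hr0, hW₁x⟩ := step_small hL hWu hx hs.1 hWx
      have hu₁ : ∀ y, (fun w => u ((L : ℤ) • w)) y ∈ unitaryUnits (Matrix n n ℂ) := fun y => hu _
      rw [cavgIter_succ L (j + 1), cavgIter_succ L (j + 1) W, cavg_gaugeAct hL hWu hx h512 hWx hu,
        ih hW₁u hr0 hs.2 hW₁x hu₁]
      congr 1
      funext w
      simp only [smul_smul, ← pow_succ']

/-- **FINITE GAUGE COVARIANCE OF THE DIFFERENTIAL OF THE (j+1)-FOLD AVERAGE**: in the multi-level small-field class,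
`cpushIter L j (W^u) (ψ^u) = (cpushIter L j W ψ)^{u ∘ L^{j+1}•}`. [cite: Balaban1985Averaging, (45) p.24] -/
theorem cpushIter_gaugeAct [Nonempty n] {L : ℕ} (hL : 1 ≤ L) (j : ℕ) :
    ∀ {W : Site d → Fin d → (Matrix n n ℂ)ˣ} {x : ℝ}, IsUnitaryCfg W → 0 ≤ x → LevelSmall d L j x → SmallField W x →
    ∀ {u : Site d → (Matrix n n ℂ)ˣ}, (∀ y, u y ∈ unitaryUnits (Matrix n n ℂ)) → ∀ (ψ : Site d → Fin d → (Matrix n n ℂ)),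
      cpushIter L j (gaugeAct u W) (fun y μ => Ad (u (y + e μ)) (ψ y μ))
        = fun z κ => Ad (u (((L : ℤ) ^ (j + 1)) • (z + e κ))) (cpushIter L j W ψ z κ) := by
  induction j with
  | zero =>
      intro W x hWu hx hs hWx u hu ψ
      obtain ⟨h512, -, -, -⟩ := step_small hL hWu hx hs hWx
      rw [cpushIter_zero', cpushIter_zero', zero_add, pow_one]
      exact cpush_gaugeAct hL hWu hx h512 hWx hu ψ
  | succ j ih =>
      intro W x hWu hx hs hWx u hu ψ
      obtain ⟨h512, hW₁u, hr0, hW₁x⟩ := step_small hL hWu hx hs.1 hWx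
      have hu₁ : ∀ y, (fun w => u ((L : ℤ) • w)) y ∈ unitaryUnits (Matrix n n ℂ) := fun y => hu _
      rw [cpushIter_succ', cpushIter_succ' L j W, cavg_gaugeAct hL hWu hx h512 hWx hu, cpush_gaugeAct hL hWu hx h512 hWx hu ψ]
      have h := ih hW₁u hr0 hs.2 hW₁x hu₁ (cpush L W ψ)
      have hre : (fun y μ => Ad ((fun w => u ((L : ℤ) • w)) (y + e μ)) (cpush L W ψ y μ))
          = fun z κ => Ad (u ((L : ℤ) • (z + e κ))) (cpush L W ψ z κ) := rfl
      rw [hre] at h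
      rw [h]
      funext z κ
      simp only [smul_smul, ← pow_succ']

/-- The two recursions of the tree agree: `dirIter L (j+1) W Y = cpushIter L j W Y`. [folklore] -/
theorem dirIter_succ_eq_cpushIter (L : ℕ) :
    ∀ (j : ℕ) (W : Site d → Fin d → (Matrix n n ℂ)ˣ) (Y : Site d → Fin d → (Matrix n n ℂ)), dirIter L (j + 1) W Y = cpushIter L j W Y
  | 0, _, _ => rfl
  | j + 1, W, Y => dirIter_succ_eq_cpushIter L j (cavg L W) (cpush L W Y)

/-- **FINITE GAUGE COVARIANCE OF `D_W = dirIter L (j+1) W`**: `dirIter L (j+1) (W^u) (ψ^u) = (dirIter L (j+1) W ψ)^{u ∘ L^{j+1}•}`. [cite: Balaban1985Averaging, (45) p.24] -/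
theorem dirIter_gaugeAct [Nonempty n] {L : ℕ} (hL : 1 ≤ L) (j : ℕ) {W : Site d → Fin d → (Matrix n n ℂ)ˣ} {x : ℝ} (hWu : IsUnitaryCfg W)
    (hx : 0 ≤ x) (hs : LevelSmall d L j x) (hWx : SmallField W x) {u : Site d → (Matrix n n ℂ)ˣ} (hu : ∀ y, u y ∈ unitaryUnits (Matrix n n ℂ))
    (ψ : Site d → Fin d → (Matrix n n ℂ)) :
    dirIter L (j + 1) (gaugeAct u W) (fun y μ => Ad (u (y + e μ)) (ψ y μ))
      = fun z κ => Ad (u (((L : ℤ) ^ (j + 1)) • (z + e κ))) (dirIter L (j + 1) W ψ z κ) := by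
  rw [dirIter_succ_eq_cpushIter, cpushIter_gaugeAct hL j hWu hx hs hWx hu ψ]
  simp only [dirIter_succ_eq_cpushIter]

end

end Summit.QuantumFields.BalabanUV.T4Continuum.NE3CpushGaugeCovariance
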